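import Literature.Claims.NS.ClayR3BlowupAlternative
import Literature.Analysis.FluidPDE.ClassicalNSL3Continuation
import Literature.Analysis.FluidPDE.NSLerayHopfSereginProofs
import HarnessLib

/-!
# Clay (A)/(C) reference — the Escauriaza–Seregin–Šverák `L^∞_t L³_x` criterion in Clay form:
# (A) ⇔ an a priori `L³` bound in the finite-energy classical class; `L³` blow-up certificates ⇒ (C)

Companion to `ClayR3BlowupAlternative.lean` ((A) ⇔ an a priori `L^∞` bound),
`ClayR3EnstrophyBridge.lean` ((A) ⇔ an a priori enstrophy bound) and `ClayR3BKMBridge.lean` ((A) ⇔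
an a priori Beale–Kato–Majda bound). With the tree's Escauriaza–Seregin–Šverák continuation theorem in
the finite-energy classical class
(`Literature.Analysis.FluidPDE.IsClassicalNSSolutionOn.exists_Icc_of_eLpNorm_three_bounded`: a
finite-energy classical solution on `[0, T) × ℝ³` from a datum of class (4) with
`sup_{[0,T)} ‖u(t)‖_{L³} < ∞` is the restriction of a finite-energy classical solution on the CLOSED
slab `[0, T]`; ESS 2003 Thm. 1.4 / Seregin 2012 Thm. 1.1 via the tree theorem
`hasSmoothExtensionPast_of_eLpNorm_three_bounded_holds`, Leray's weak solution supplying the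
Leray–Hopf structure at the endpoint) the critical `L³` norm joins the list of quantities whose a
priori control IS Fefferman's (A):

* `clayR3_regularityAt_iff_aprioriL3Bound` / `clayR3_regularity_iff_aprioriL3Bound(_at)` — **(A) ⇔
  the a priori `L³` bound**: for `μ > 0`, `clayR3.RegularityAt μ` holds iff every classical solution
  of the unforced system on a half-open slab `[0, T) × ℝ³` from a smooth divergence-free datum of
  class (4), with energy bounded on `[0, T)`, has `(⨆ t ∈ [0,T), ‖u(t)‖_{L³}) < ∞` (one viscosity ⇔
  every viscosity, `clayR3_regularityAt_iff`). «(A) ⇔ no finite-time `L³` blow-up» is the printed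
  reading of ESS Thm. 1.4 together with Leray's structure theorem;
* `biSup_eLpNorm_three_lt_top_of_clayR3_solvable` — (A)-solvability of one Cauchy problem bounds the
  `L³` norm of every finite-energy classical solution from the same datum on its horizon;
* `not_clayR3_solvable_of_L3BlowupCertificate` / `navierStokesBreakdownR3_of_L3BlowupCertificate` —
  an **`L³` blow-up certificate** (a finite-energy classical solution on `[0, T) × ℝ³` from a datum
  of class (4) with `(⨆ t ∈ [0,T), ‖u(t)‖_{L³}) = ∞`) excludes (A)-solvability of that datum and
  proves the unforced instance of (C) (`NavierStokesBreakdownR3`);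
* `not_clayR3_solvable_iff_exists_L3Blowup` — `(μ, 0, u₀)` is NOT Clay-solvable ⇔ some
  finite-energy classical solution from `u₀` on a half-open slab has unbounded `L³` norm;
* `exists_L3Blowup_of_not_clayR3_regularity` — `¬(A)` ⇒ such a certificate exists.

Usage on a CARD (§3): a REG claim printed as «the `L³` norm of every smooth finite-energy solution
stays bounded on its interval of existence, hence by Escauriaza–Seregin–Šverák the solution is
global» for class-(4) data IS (A) by `clayR3_regularity_iff_aprioriL3Bound` — the ESS step and the
«local existence + continuation» prose are supplied by the tree, no Δ6 delta; what stays a delta is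
the solution class over which the bound is asserted (no energy hypothesis, smoothness on the open
half-space only: Δ5, cf. C93 `Nwankpa2025`) and bounds asserted only for GLOBAL solutions (an a
priori bound must cover half-open slabs). A NEG claim printed as «`‖u(t)‖_{L³} → ∞` as `t ↑ T*`»
is (C) exactly when the solution is a finite-energy classical one from a class-(4) datum
(`navierStokesBreakdownR3_of_L3BlowupCertificate`).

## References
* C. L. Fefferman, *Existence and smoothness of the Navier–Stokes equation*, CMI 2006, (A), (C) with
  (4)–(7) p. 2. [FeffermanClay2006]
* L. Escauriaza, G. Seregin, V. Šverák, Russ. Math. Surveys 58 (2003) 211–250, Thms. 1.3–1.4.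
  [EscauriazaSereginSverak2003]
* G. Seregin, Comm. Math. Phys. 312 (2012) 833–845, Thm. 1.1. [Seregin2012CMP]
* J. Leray, Acta Math. 63 (1934), §33–§34. [Leray1934]
* T. Tao, Anal. PDE 6 (2013) = arXiv:1108.1165: Conj. 1.3, Lemma 8.1, Cor. 11.1, Cor. 11.4.
  [Tao2013Localisation] (proofs-file key `Tao2011`)

WHAT THIS IS NOT: not a claim about NS regularity or blow-up; not a claim about any author beyond
the typed locator.
-/

open scoped ContDiff ENNReal NNReal Topology

namespace Literature.Claims.NS.ClayVariants

open Set Filter MeasureTheory Function Literature.Analysis Literature.Analysis.FluidPDE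

noncomputable section

variable {μ T : ℝ} {u₀ : EuclideanSpace ℝ (Fin 3) → EuclideanSpace ℝ (Fin 3)}
  {u : ℝ → EuclideanSpace ℝ (Fin 3) → EuclideanSpace ℝ (Fin 3)}
  {p : ℝ → EuclideanSpace ℝ (Fin 3) → ℝ}

/-! ## `L^∞ ∩ L²` control gives `L³` control -/

/-- **A pointwise bound and an energy bound on a slab bound the `L³` norms**: if `‖u(t,x)‖ ≤ M` and
`∫ ‖u(t)‖² ≤ A < ∞` for `t ∈ [0, T)`, with continuous slices, then
`(⨆ t ∈ [0,T), ‖u(t)‖_{L³}) < ∞` (`‖f‖₃³ ≤ ‖f‖_∞ ‖f‖₂²`). Private helper. [folklore] -/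
private theorem biSup_eLpNorm_three_lt_top_of_bounds {M : ℝ} {A : ℝ≥0∞} (hA : A < ⊤)
    (hmeas : ∀ t ∈ Ico 0 T, AEStronglyMeasurable (u t) volume)
    (hM : ∀ t ∈ Ico 0 T, ∀ x, ‖u t x‖ ≤ M) (hE : ∀ t ∈ Ico 0 T, ∫⁻ x, ‖u t x‖ₑ ^ 2 ≤ A) :
    (⨆ t ∈ Ico 0 T, eLpNorm (u t) 3 volume) < ⊤ := by
  have key : ∀ t ∈ Ico 0 T, eLpNorm (u t) 3 volume ≤ (ENNReal.ofReal M * A) ^ (3 : ℝ)⁻¹ := by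
    intro t ht
    have h3 : eLpNorm (u t) 3 volume ^ 3 ≤ eLpNorm (u t) ⊤ volume * eLpNorm (u t) 2 volume ^ 2 :=
      eLpNorm_three_pow_le (hmeas t ht)
    have htop : eLpNorm (u t) ⊤ volume ≤ ENNReal.ofReal M := eLpNorm_top_le_of_bound (hM t ht)
    have h2 : eLpNorm (u t) 2 volume ^ 2 ≤ A := by
      have h := eLpNorm_natCast_pow_eq_lintegral volume (u t) (n := 2) (by norm_num)
      simp only [Nat.cast_ofNat] at h
      rw [h]
      exact hE t ht
    have hle : eLpNorm (u t) 3 volume ^ (3 : ℝ) ≤ ENNReal.ofReal M * A := by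
      rw [ENNReal.rpow_ofNat]
      exact h3.trans (mul_le_mul' htop h2)
    exact (ENNReal.le_rpow_inv_iff (by norm_num : (0 : ℝ) < 3)).2 hle
  refine lt_of_le_of_lt (iSup₂_le key) ?_
  exact ENNReal.rpow_lt_top_of_nonneg (by positivity)
    (ENNReal.mul_lt_top ENNReal.ofReal_lt_top hA).ne

/-! ## (A)-solvability bounds the `L³` norm on every horizon -/

/-- **Clay (A)-solvability bounds the `L³` norm of every finite-energy classical solution from the
same datum on its horizon.** Let `μ > 0`, `u₀` a smooth datum of class (4), and `(u, p)` a classical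
solution of the unforced system on `[0, T) × ℝ³` with `u 0 = u₀` and finite energy on `[0, T)`. If
`(μ, 0, u₀)` is Clay-solvable, then `(⨆ t ∈ [0,T), ‖u(t)‖_{L³}) < ∞`: the Clay solution equals `u` on
`[0, T)` and is bounded there (`exists_bounds_of_clayR3_solvable`, Tao's Cor. 11.4 + Cor. 11.1), and
`‖u(t)‖₃³ ≤ ‖u(t)‖_∞ ‖u(t)‖₂²`. [cite: FeffermanClay2006, (A) with (4) (6) (7) p. 2]
[cite: Tao2011, Cor. 11.4 + Cor. 11.1] -/
theorem biSup_eLpNorm_three_lt_top_of_clayR3_solvable (hμ : 0 < μ) (hu₀ : ContDiff ℝ ∞ u₀)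
    (hdec : HasRapidSpatialDecay u₀)
    (hcl : IsClassicalNSSolutionOn (Ico 0 T) μ 0 u p) (hu0 : u 0 = u₀)
    (hE : ∃ A : ℝ≥0∞, A < ⊤ ∧ ∀ t ∈ Ico 0 T, ∫⁻ x, ‖u t x‖ₑ ^ 2 ≤ A)
    (hsol : clayR3.Solvable μ 0 u₀) :
    (⨆ t ∈ Ico 0 T, eLpNorm (u t) 3 volume) < ⊤ := by
  obtain ⟨M, hM⟩ := exists_bounds_of_clayR3_solvable hμ (hu₀.of_le (by norm_cast)) hdec hcl hu0
    hE hsol 0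
  obtain ⟨A, hA, hb⟩ := hE
  refine biSup_eLpNorm_three_lt_top_of_bounds (M := M) hA
    (fun t ht => (hcl.contDiff_velocity ht).continuous.aestronglyMeasurable)
    (fun t ht x => ?_) hb
  simpa using hM t ht x

/-! ## `L³` blow-up certificates exclude (A)-solvability and prove (C) -/

/-- **An `L³` BLOW-UP CERTIFICATE excludes Clay solvability**: a classical solution of the unforced
system on `[0, T) × ℝ³` from a smooth datum of class (4), with energy bounded on `[0, T)` and
`(⨆ t ∈ [0,T), ‖u(t)‖_{L³}) = ∞`, shows that `(μ, 0, u₀)` has no Clay (A)-class solution.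
[cite: FeffermanClay2006, (A) (C) with (4)–(7) p. 2] [cite: EscauriazaSereginSverak2003, Thm. 1.4]
[cite: Tao2011, Cor. 11.4 + Cor. 11.1] -/
theorem not_clayR3_solvable_of_L3BlowupCertificate (hμ : 0 < μ) (hu₀ : ContDiff ℝ ∞ u₀)
    (hdec : HasRapidSpatialDecay u₀)
    (hcl : IsClassicalNSSolutionOn (Ico 0 T) μ 0 u p) (hu0 : u 0 = u₀)
    (hE : ∃ A : ℝ≥0∞, A < ⊤ ∧ ∀ t ∈ Ico 0 T, ∫⁻ x, ‖u t x‖ₑ ^ 2 ≤ A)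
    (hblow : (⨆ t ∈ Ico 0 T, eLpNorm (u t) 3 volume) = ⊤) :
    ¬ clayR3.Solvable μ 0 u₀ := fun hsol =>
  (biSup_eLpNorm_three_lt_top_of_clayR3_solvable hμ hu₀ hdec hcl hu0 hE hsol).ne hblow

/-- **An `L³` blow-up certificate proves the unforced instance of (C)** (`NavierStokesBreakdownR3`,
via the tree's `navierStokesBreakdownR3_of_not_solvable`). [cite: FeffermanClay2006, (C) with (4)–(7) p. 2]
[cite: EscauriazaSereginSverak2003, Thm. 1.4] -/
theorem navierStokesBreakdownR3_of_L3BlowupCertificate (hμ : 0 < μ) (hu₀ : ContDiff ℝ ∞ u₀)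
    (hdiv : NSWave0.IsDivFree u₀) (hdec : HasRapidSpatialDecay u₀)
    (hcl : IsClassicalNSSolutionOn (Ico 0 T) μ 0 u p) (hu0 : u 0 = u₀)
    (hE : ∃ A : ℝ≥0∞, A < ⊤ ∧ ∀ t ∈ Ico 0 T, ∫⁻ x, ‖u t x‖ₑ ^ 2 ≤ A)
    (hblow : (⨆ t ∈ Ico 0 T, eLpNorm (u t) 3 volume) = ⊤) :
    Summit.NavierStokesRegularity.NavierStokesRegularity.NavierStokesBreakdownR3 :=
  navierStokesBreakdownR3_of_not_solvable hμ hu₀ hdiv hdec isSmoothOnHalfSpace_zero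
    clayR3_force_zero (not_clayR3_solvable_of_L3BlowupCertificate hμ hu₀ hdec hcl hu0 hE hblow)

/-! ## (A) ⇔ the a priori `L³` bound -/

/-- **Clay (A) at viscosity `μ` ⇔ the a priori `L³` bound in the finite-energy classical class**
(Escauriaza–Seregin–Šverák 2003 Thm. 1.4 read with Leray's structure theorem): for `μ > 0`,
`clayR3.RegularityAt μ` (every smooth divergence-free datum of class (4) has a smooth bounded-energy
solution on `ℝ³ × [0,∞)`) holds iff for every such datum, every `T` and every classical solution
`(u, p)` of the unforced system on `[0, T) × ℝ³` with `u 0 = u₀` and energy bounded on `[0, T)`, the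
`L³` norms are bounded: `(⨆ t ∈ [0,T), ‖u(t)‖_{L³}) < ∞`. (⇒): uniqueness against the Clay solution,
which is bounded on `[0, T]` (`biSup_eLpNorm_three_lt_top_of_clayR3_solvable`); (⇐): by the blow-up
alternative (`clayR3_solvable_or_supBlowup`) a non-solvable datum carries a maximal finite-energy
classical solution on some `[0, T*)`, `T* > 0`, admitting no finite-energy classical continuation to
`[0, T*]`; its `L³` norms are bounded by hypothesis, so the ESS continuation theorem
(`IsClassicalNSSolutionOn.exists_Icc_of_eLpNorm_three_bounded`) continues it to `[0, T*]` —
contradiction. [cite: FeffermanClay2006, (A) with (4) (6) (7) p. 2]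
[cite: EscauriazaSereginSverak2003, Thm. 1.4] [cite: Seregin2012CMP, Thm. 1.1]
[cite: Leray1934, §33] [cite: Tao2011, Conj. 1.3, Lemma 8.1, Cor. 11.1, Cor. 11.4] -/
theorem clayR3_regularityAt_iff_aprioriL3Bound (hμ : 0 < μ) :
    clayR3.RegularityAt μ ↔
      ∀ (u₀ : EuclideanSpace ℝ (Fin 3) → EuclideanSpace ℝ (Fin 3)), ContDiff ℝ ∞ u₀ →
        NSWave0.IsDivFree u₀ → HasRapidSpatialDecay u₀ →
        ∀ (T : ℝ) (u : ℝ → EuclideanSpace ℝ (Fin 3) → EuclideanSpace ℝ (Fin 3))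
          (p : ℝ → EuclideanSpace ℝ (Fin 3) → ℝ),
          IsClassicalNSSolutionOn (Ico 0 T) μ 0 u p → u 0 = u₀ →
          (∃ A : ℝ≥0∞, A < ⊤ ∧ ∀ t ∈ Ico 0 T, ∫⁻ x, ‖u t x‖ₑ ^ 2 ≤ A) →
            (⨆ t ∈ Ico 0 T, eLpNorm (u t) 3 volume) < ⊤ := by
  constructor
  · intro hreg u₀ hu₀ hdiv hdec T u p hcl hu0 hE
    exact biSup_eLpNorm_three_lt_top_of_clayR3_solvable hμ hu₀ hdec hcl hu0 hE
      (hreg u₀ hu₀ hdiv hdec)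
  · intro hbd u₀ hu₀ hdiv hdec
    rcases clayR3_solvable_or_supBlowup hμ hu₀ hdiv hdec with
      hsol | ⟨Ts, hTs, u, p, hcl, hu0, hE, -, hmax⟩
    · exact hsol
    · exfalso
      have hL3 := hbd u₀ hu₀ hdiv hdec Ts u p hcl hu0 hE
      have hdec0 : HasRapidSpatialDecay (u 0) := by
        rw [hu0]
        exact hdec
      obtain ⟨u', p', hcl', heq, hE'⟩ :=
        hcl.exists_Icc_of_eLpNorm_three_bounded hμ hTs hdec0 hE hL3
      exact hmax Ts le_rfl u' p' hcl' (by rw [heq 0 ⟨le_rfl, hTs⟩, hu0]) hE'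

/-- **(A) ⇔ the a priori `L³` bound at every viscosity.** `clayR3.Regularity` is token-for-token the
summit statement `NavierStokesRegularity`. [cite: FeffermanClay2006, (A) with (4) (6) (7) p. 2]
[cite: EscauriazaSereginSverak2003, Thm. 1.4] [cite: Tao2011, Conj. 1.3, Cor. 11.1, Cor. 11.4] -/
theorem clayR3_regularity_iff_aprioriL3Bound :
    clayR3.Regularity ↔
      ∀ μ : ℝ, 0 < μ →
      ∀ (u₀ : EuclideanSpace ℝ (Fin 3) → EuclideanSpace ℝ (Fin 3)), ContDiff ℝ ∞ u₀ →
        NSWave0.IsDivFree u₀ → HasRapidSpatialDecay u₀ →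
        ∀ (T : ℝ) (u : ℝ → EuclideanSpace ℝ (Fin 3) → EuclideanSpace ℝ (Fin 3))
          (p : ℝ → EuclideanSpace ℝ (Fin 3) → ℝ),
          IsClassicalNSSolutionOn (Ico 0 T) μ 0 u p → u 0 = u₀ →
          (∃ A : ℝ≥0∞, A < ⊤ ∧ ∀ t ∈ Ico 0 T, ∫⁻ x, ‖u t x‖ₑ ^ 2 ≤ A) →
            (⨆ t ∈ Ico 0 T, eLpNorm (u t) 3 volume) < ⊤ :=
  ⟨fun h μ hμ => (clayR3_regularityAt_iff_aprioriL3Bound hμ).1 (h μ hμ),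
    fun h μ hμ => (clayR3_regularityAt_iff_aprioriL3Bound hμ).2 (h μ hμ)⟩

/-- **(A) ⇔ the a priori `L³` bound at ONE viscosity `μ > 0`** (Δ7 scaling,
`clayR3_regularityAt_iff`). [cite: FeffermanClay2006, (A) with (4) (6) (7) p. 2]
[cite: EscauriazaSereginSverak2003, Thm. 1.4] [cite: Tao2011, Conj. 1.3, Cor. 11.1, Cor. 11.4] -/
theorem clayR3_regularity_iff_aprioriL3Bound_at (hμ : 0 < μ) :
    clayR3.Regularity ↔
      ∀ (u₀ : EuclideanSpace ℝ (Fin 3) → EuclideanSpace ℝ (Fin 3)), ContDiff ℝ ∞ u₀ →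
        NSWave0.IsDivFree u₀ → HasRapidSpatialDecay u₀ →
        ∀ (T : ℝ) (u : ℝ → EuclideanSpace ℝ (Fin 3) → EuclideanSpace ℝ (Fin 3))
          (p : ℝ → EuclideanSpace ℝ (Fin 3) → ℝ),
          IsClassicalNSSolutionOn (Ico 0 T) μ 0 u p → u 0 = u₀ →
          (∃ A : ℝ≥0∞, A < ⊤ ∧ ∀ t ∈ Ico 0 T, ∫⁻ x, ‖u t x‖ₑ ^ 2 ≤ A) →
            (⨆ t ∈ Ico 0 T, eLpNorm (u t) 3 volume) < ⊤ := by
  rw [← clayR3_regularityAt_iff hμ]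
  exact clayR3_regularityAt_iff_aprioriL3Bound hμ

/-! ## (A)-solvability FAILS iff an `L³` blow-up certificate exists -/

/-- **`(μ, 0, u₀)` is NOT Clay-solvable ⇔ some finite-energy classical solution from `u₀` on a
half-open slab `[0, T) × ℝ³`, `T > 0`, has unbounded `L³` norm there.** (⇒): the maximal
finite-energy classical solution of the blow-up alternative (`clayR3_solvable_or_supBlowup`) has
`(⨆ t < T*, ‖u(t)‖_{L³}) = ∞`, else the ESS continuation theorem would continue it to `[0, T*]`;
(⇐): `not_clayR3_solvable_of_L3BlowupCertificate`. [cite: FeffermanClay2006, (A) (C) with (4)–(7) p. 2]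
[cite: EscauriazaSereginSverak2003, Thm. 1.4] [cite: Seregin2012CMP, Thm. 1.1] [cite: Leray1934, §33] -/
theorem not_clayR3_solvable_iff_exists_L3Blowup (hμ : 0 < μ) (hu₀ : ContDiff ℝ ∞ u₀)
    (hdiv : NSWave0.IsDivFree u₀) (hdec : HasRapidSpatialDecay u₀) :
    ¬ clayR3.Solvable μ 0 u₀ ↔
      ∃ T : ℝ, 0 < T ∧
        ∃ (u : ℝ → EuclideanSpace ℝ (Fin 3) → EuclideanSpace ℝ (Fin 3))
          (p : ℝ → EuclideanSpace ℝ (Fin 3) → ℝ),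
          IsClassicalNSSolutionOn (Ico 0 T) μ 0 u p ∧ u 0 = u₀ ∧
          (∃ A : ℝ≥0∞, A < ⊤ ∧ ∀ t ∈ Ico 0 T, ∫⁻ x, ‖u t x‖ₑ ^ 2 ≤ A) ∧
          (⨆ t ∈ Ico 0 T, eLpNorm (u t) 3 volume) = ⊤ := by
  constructor
  · intro hno
    rcases clayR3_solvable_or_supBlowup hμ hu₀ hdiv hdec with
      hsol | ⟨Ts, hTs, u, p, hcl, hu0, hE, -, hmax⟩
    · exact absurd hsol hno
    · refine ⟨Ts, hTs, u, p, hcl, hu0, hE, ?_⟩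
      by_contra hlt
      have hL3 : (⨆ t ∈ Ico 0 Ts, eLpNorm (u t) 3 volume) < ⊤ := lt_top_iff_ne_top.2 hlt
      have hdec0 : HasRapidSpatialDecay (u 0) := by
        rw [hu0]
        exact hdec
      obtain ⟨u', p', hcl', heq, hE'⟩ :=
        hcl.exists_Icc_of_eLpNorm_three_bounded hμ hTs hdec0 hE hL3
      exact hmax Ts le_rfl u' p' hcl' (by rw [heq 0 ⟨le_rfl, hTs⟩, hu0]) hE'
  · rintro ⟨T, -, u, p, hcl, hu0, hE, hblow⟩
    exact not_clayR3_solvable_of_L3BlowupCertificate hμ hu₀ hdec hcl hu0 hE hblow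

/-- **`¬(A)` ⇒ an `L³` blow-up certificate exists**: if Fefferman's (A) fails, some `μ > 0` and some
datum of class (4) carry a finite-energy classical solution on a half-open slab whose `L³` norm is
unbounded. [cite: FeffermanClay2006, (A) with (4) (6) (7) p. 2] [cite: EscauriazaSereginSverak2003, Thm. 1.4]
[cite: Leray1934, §33] -/
theorem exists_L3Blowup_of_not_clayR3_regularity (h : ¬ clayR3.Regularity) :
    ∃ μ : ℝ, 0 < μ ∧ ∃ u₀ : EuclideanSpace ℝ (Fin 3) → EuclideanSpace ℝ (Fin 3),
      ContDiff ℝ ∞ u₀ ∧ NSWave0.IsDivFree u₀ ∧ HasRapidSpatialDecay u₀ ∧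
      ∃ T : ℝ, 0 < T ∧
        ∃ (u : ℝ → EuclideanSpace ℝ (Fin 3) → EuclideanSpace ℝ (Fin 3))
          (p : ℝ → EuclideanSpace ℝ (Fin 3) → ℝ),
          IsClassicalNSSolutionOn (Ico 0 T) μ 0 u p ∧ u 0 = u₀ ∧
          (∃ A : ℝ≥0∞, A < ⊤ ∧ ∀ t ∈ Ico 0 T, ∫⁻ x, ‖u t x‖ₑ ^ 2 ≤ A) ∧
          (⨆ t ∈ Ico 0 T, eLpNorm (u t) 3 volume) = ⊤ := by
  unfold ClaySpec.Regularity ClaySpec.RegularityAt at h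
  push Not at h
  obtain ⟨μ, hμ, u₀, hu₀, hdiv, hdec, hno⟩ := h
  exact ⟨μ, hμ, u₀, hu₀, hdiv, hdec,
    (not_clayR3_solvable_iff_exists_L3Blowup hμ hu₀ hdiv hdec).1 hno⟩

end

end Literature.Claims.NS.ClayVariants

-- WHAT THIS IS NOT: not a claim about NS regularity or blow-up; not a claim about any author beyond
-- the typed locator.
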